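import Summits.ResolutionOfSingularities.ResolutionOfSingularities.Theses.CleanCovers
import Summits.ResolutionOfSingularities.ResolutionOfSingularities.Theorems.WeightedInvariantWeightedThesisProjectiveIntegralSuffices
import Literature.AlgebraicGeometry.Resolution.KedlayaEtaleCoversProofs
import HarnessLib

/-!
# `CleanCovers.KedlayaReduction` (stmt-ResolutionOfSingularities-15241) — PROVED

Route `ResolutionOfSingularities/CleanCovers`, crux `KedlayaReduction` (rank 3): for every prime
`p`, if every integral scheme finite surjective over `ℙⁿ_k` (`k` perfect of characteristic `p`)
and étale over the standard chart `D₊(xₙ) ≅ 𝔸ⁿ_k` has a resolution, then every reduced separated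
scheme of finite type over a perfect field of characteristic `p` has a resolution.

Proof (the route's "proof on paper", both ingredients PROVED in the tree, no named fact):
* the projective reduction
  `Theorems.WeightedThesis.ProjectiveIntegralSuffices.stub_projectiveIntegralSuffices`
  (irreducible components with the reduced structure, Chow's lemma, projective closure;
  Cossart–Piltant 2019, Prop. 4.6, Steps 1–3): it suffices to resolve the integral closed
  subschemes `Z ⊆ ℙᴺ_k`;
* Kedlaya 2005, Thm. 1 in the tree's proved specialised form
  `Literature.AlgebraicGeometry.Resolution.Kedlaya2004_finite_etale_off_hyperplane_holds`: an
  integral `Z` finite over `ℙᴺ_k`, `k` perfect, admits a finite surjective `k`-morphism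
  `g : Z → ℙⁿ_k` étale over `D₊(xₙ)` (a closed immersion is finite, so no normalisation step is
  needed);
* the antecedent `CoverResolution` at `p` then resolves `Z`.
The same 8-line argument was found independently by the crux's standing disprover
(`Cruxes/KedlayaReduction/Disproof.lean`, `perfectResolutionAt_of_coverResolutionAt`).
-/

-- single-problem summit: the doubled namespace component `ResolutionOfSingularities` is forced
set_option linter.dupNamespace false

namespace Summit.ResolutionOfSingularities.ResolutionOfSingularities.Theorems

open CategoryTheory AlgebraicGeometry Literature.AlgebraicGeometry.Resolution

/-- **`CleanCovers.KedlayaReduction` holds** (stmt-ResolutionOfSingularities-15241): for every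
prime `p`, resolution of Kedlaya covers (integral schemes finite surjective over `ℙⁿ_k`, `k`
perfect of characteristic `p`, étale over the chart `D₊(xₙ)`) implies resolution of every reduced
separated scheme of finite type over every perfect field of characteristic `p`. Proof: the
projective reduction `stub_projectiveIntegralSuffices` (components, Chow, projective closure)
reduces to integral closed subschemes `Z ⊆ ℙᴺ_k`; Kedlaya's theorem
(`Kedlaya2004_finite_etale_off_hyperplane_holds`, Kedlaya 2005 Thm. 1, proved in the tree) makes
`Z` a finite surjective cover of some `ℙⁿ_k` étale over `D₊(xₙ)`; the antecedent resolves it.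
[cite: Kedlaya2004, Thm. 1] -/
theorem kedlayaReduction_proof :
    Summit.ResolutionOfSingularities.ResolutionOfSingularities.Theses.CleanCovers.KedlayaReduction := by
  unfold Theses.CleanCovers.KedlayaReduction
  intro p hp hC k _ _ _ X f hsep hlft hqc hred
  refine WeightedThesis.ProjectiveIntegralSuffices.stub_projectiveIntegralSuffices k ?_ X f
    hsep hlft hqc hred
  intro N Z ι hι hint
  haveI := hι
  obtain ⟨n, g, -, hfin, hsurj, het⟩ :=
    Kedlaya2004_finite_etale_off_hyperplane_holds p hp k N Z ι hint inferInstance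
  exact hC k n Z g hint hfin hsurj het

end Summit.ResolutionOfSingularities.ResolutionOfSingularities.Theorems
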